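import Literature.Algebra.EuclideanLattices.RegevTwoPointDigits
import Literature.Algebra.EuclideanLattices.Encoding
import Literature.Computability.Complexity.CodeFPBudgets
import Literature.Computability.Complexity.CodeFPLists
import HarnessLib

/-!
# Regev 2004, proof of Thm. 1.1: from the DCP answers to the shortest vector — inverting the hidden shift, selecting the shortest candidate

Topic `Algebra/EuclideanLattices` (family `pqc`); proved material towards the discharge of the
named fact `Literature.Algebra.EuclideanLattices.usvp_of_dihedralCoset` (O. Regev, *Quantum
computation and lattice problems*, SIAM J. Comput. 33 (2004) 738–760, Thm. 1.1). No named fact is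
introduced; everything is proved.

The outer loop of the proof of Thm. 1.1 (p. 7) runs the two-point/DCP routine for every guess
(prime `p > n^{2+2f}`, residue `1 ≤ m < p`, index `i₀`, radius), obtaining each time a vector
`δ̄ = ((u_{i₀} − m)/p, …, uᵢ, …)` (`RegevTwoPoint.hiddenShift`) when the guess is right and
garbage otherwise, turns it back into a coefficient vector `ū' = (…, p δ_{i₀} + m, …)`, and
outputs the SHORTEST NONZERO lattice vector `∑ u'ᵢ bᵢ` among all candidates: if the shortest vector
is among the candidates, the output is a shortest vector. This file proves exactly this classical
step, as list programs with their polynomial-time (`CodeFP`) realisations: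

* `shiftToCoeffs i₀ p m δ̄` with **`shiftToCoeffs_hiddenShift`** (`p ∣ u_{i₀} − m ⇒` it recovers
  `ū`), the magnitude bound `natAbs_hiddenShift_le` (`|δᵢ| ≤ |uᵢ| + |m|`, what the base-`2M`
  decoding of Lemma 3.2 needs) and, with `RegevTwoPointDigits.lean`, the end-to-end
  **`shiftToCoeffs_decodeShift_dcpShift`** / `candidate_eq_ofFn`: the DCP answer of the right guess
  decodes to `ū`; `candidateFP` (decode, then undo the shift, on codes);
* list programs `vecMulL n c B = c ᵥ* B` (`vecMulL_ofFn`), `sqNormL`, the selection fold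
  `selStep`/`selectL` and its specification `selectL_spec` (the selected coefficient list is a
  candidate of minimal nonzero squared norm), `shortestVecL`;
* **`isSolution_shortestVecL`**: if some candidate's lattice vector is a shortest nonzero vector
  of `L(B)` (`USVP.IsSolution`), so is the selected one;
* **`shortestVecLFP`**: `(1ⁿ, B, candidates) ↦ shortestVecL n B candidates` is polynomial time
  (typed `CodeFP`; the fold's accumulator is an input item and one bounded integer), and
  `shiftToCoeffsFP`; unpacked `∃ f ∈ FP` forms.

## References

* O. Regev, *Quantum computation and lattice problems*, SIAM J. Comput. 33 (2004) 738–760,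
  proof of Thm. 1.1 (p. 7: the loop over the guesses; "output the shortest vector found") and
  Lemma 3.12 (the answer `δ̄`) [Regev2004].
* S. Arora, B. Barak, *Computational Complexity: A Modern Approach*, CUP 2009, §1.3.
-/

noncomputable section

namespace Literature.Algebra.EuclideanLattices

namespace Regev2004

open Finset

variable {n : ℕ}

/-! ### Inverting the hidden shift -/

/-- From the answer `δ̄` of the two-point problem back to a coefficient vector:
`ū' = (δ₁, …, p δ_{i₀} + m, …, δₙ)`. [cite: Regev2004, Thm. 1.1 (proof, p. 7)] -/
def shiftToCoeffs (i₀ : Fin n) (p m : ℤ) (δ : Fin n → ℤ) : Fin n → ℤ :=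
  Function.update δ i₀ (p * δ i₀ + m)

/-- At `i₀`. [folklore] -/
@[simp] theorem shiftToCoeffs_self (i₀ : Fin n) (p m : ℤ) (δ : Fin n → ℤ) :
    shiftToCoeffs i₀ p m δ i₀ = p * δ i₀ + m := by
  simp [shiftToCoeffs]

/-- Elsewhere. [folklore] -/
@[simp] theorem shiftToCoeffs_of_ne {i₀ i : Fin n} (h : i ≠ i₀) (p m : ℤ) (δ : Fin n → ℤ) :
    shiftToCoeffs i₀ p m δ i = δ i := by
  simp [shiftToCoeffs, h]

/-- **The right guess recovers the coefficients of the shortest vector**: if `p ∣ u_{i₀} − m` then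
`shiftToCoeffs i₀ p m (hiddenShift i₀ p m u) = u`. [cite: Regev2004, Thm. 1.1 (proof, p. 7) and Lemma 3.12] -/
theorem shiftToCoeffs_hiddenShift (i₀ : Fin n) {p m : ℤ} {u : Fin n → ℤ} (hum : p ∣ u i₀ - m) :
    shiftToCoeffs i₀ p m (hiddenShift i₀ p m u) = u := by
  funext i
  by_cases hi : i = i₀
  · subst hi
    rw [shiftToCoeffs_self, hiddenShift_self, Int.mul_ediv_cancel' hum]
    ring
  · rw [shiftToCoeffs_of_ne hi, hiddenShift_of_ne hi]

/-- **The hidden shift is small**: `|δᵢ| ≤ |uᵢ| + |m|` (with Lemma 3.3's `|uᵢ| ≤ 2^{2n}` this puts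
`δ̄` in the range `|δᵢ| < M = 2^{4n}` of the base-`2M` decoding). [cite: Regev2004, Lemma 3.3 and Lemma 3.12 (proof)] -/
theorem natAbs_hiddenShift_le (i₀ : Fin n) (p m : ℤ) (u : Fin n → ℤ) (i : Fin n) :
    (hiddenShift i₀ p m u i).natAbs ≤ (u i).natAbs + m.natAbs := by
  by_cases hi : i = i₀
  · subst hi
    rw [hiddenShift_self]
    refine (Int.natAbs_ediv_le_natAbs _ _).trans ?_
    omega
  · rw [hiddenShift_of_ne hi]
    omega

/-- **End to end: the right guess's DCP answer decodes to the coefficients of the shortest vector.**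
With `M` above every `|uᵢ| + |m|` and `p ∣ u_{i₀} − m`, decoding the DCP shift of the hidden
difference (`RegevTwoPointDigits.decodeShift_dcpShift`) and undoing the shift gives back `u`.
[cite: Regev2004, Thm. 1.1 (proof, p. 7) with Lemmas 3.2, 3.3, 3.12] -/
theorem shiftToCoeffs_decodeShift_dcpShift (i₀ : Fin n) {p m : ℤ} {u : Fin n → ℤ} {M : ℕ} (hum : p ∣ u i₀ - m)
    (hM : ∀ i, (u i).natAbs + m.natAbs < M) :
    shiftToCoeffs i₀ p m (decodeShift (2 * M) M n (dcpShift (2 * M) n (hiddenShift i₀ p m u))) = u := by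
  rw [decodeShift_dcpShift fun i => (natAbs_hiddenShift_le i₀ p m u i).trans_lt (hM i), shiftToCoeffs_hiddenShift i₀ hum]

/-! ### Coefficient vectors, lattice vectors and squared norms as list programs -/

/-- `c ᵥ* B` on lists: entry `j < n` is `∑_{i<n} cᵢ Bᵢⱼ` (missing entries read as `0`). [folklore] -/
def vecMulL (n : ℕ) (c : List ℤ) (B : List (List ℤ)) : List ℤ :=
  (List.range n).map fun j => ((List.range n).map fun i => c.getD i 0 * (B.getD i []).getD j 0).sum

/-- The squared norm of an integer list. [folklore] -/
def sqNormL (v : List ℤ) : ℤ := (v.map fun x => x ^ 2).sum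

/-- A sum over `Fin n` of a function of the index is the sum of the mapped range. [folklore] -/
theorem sum_fin_eq_sum_map_range {M : Type} [AddCommMonoid M] (f : ℕ → M) (n : ℕ) :
    ∑ i : Fin n, f i = ((List.range n).map f).sum := by
  rw [← List.sum_ofFn, ofFn_eq_map_range']

/-- Entries of `List.ofFn`, read with a default. [folklore] -/
theorem getD_ofFn {α : Type} (f : Fin n → α) (d : α) (i : Fin n) : (List.ofFn f).getD i d = f i := by
  rw [List.getD_eq_getElem _ _ (by simp)]
  simp

/-- **`vecMulL` is `Matrix.vecMul`** on genuine codes: for the list of rows of `B` and the list of a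
coefficient vector `c`. [folklore] -/
theorem vecMulL_ofFn (c : Fin n → ℤ) (B : Matrix (Fin n) (Fin n) ℤ) :
    vecMulL n (List.ofFn c) (List.ofFn fun i => List.ofFn (B i)) = List.ofFn (Matrix.vecMul c B) := by
  set f : ℕ → ℕ → ℤ := fun j i => (List.ofFn c).getD i 0 * ((List.ofFn fun i => List.ofFn (B i)).getD i []).getD j 0 with hf
  have key : ∀ j : Fin n, Matrix.vecMul c B j = ((List.range n).map (f j)).sum := by
    intro j
    have e : Matrix.vecMul c B j = ∑ i, c i * B i j := by simp [Matrix.vecMul, dotProduct]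
    have hterm : ∀ i : Fin n, c i * B i j = f j i := fun i => by
      simp only [hf, getD_ofFn]
    rw [e, Finset.sum_congr rfl fun i _ => hterm i, sum_fin_eq_sum_map_range (f j) n]
  rw [vecMulL, ← ofFn_eq_map_range']
  congr 1
  funext j
  exact (key j).symm

/-- **`sqNormL` is the squared Euclidean norm** of an integer vector. [folklore] -/
theorem sqNormL_ofFn_cast (v : Fin n → ℤ) : (sqNormL (List.ofFn v) : ℝ) = ‖intVecToEuclidean n v‖ ^ 2 := by
  rw [norm_intVecToEuclidean, Real.sq_sqrt (Finset.sum_nonneg fun j _ => sq_nonneg _), sqNormL, List.map_ofFn,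
    List.sum_ofFn]
  push_cast
  simp only [Function.comp_apply, Int.cast_pow]

/-- `sqNormL (List.ofFn v) = ∑ⱼ vⱼ²`. [folklore] -/
theorem sqNormL_ofFn (v : Fin n → ℤ) : sqNormL (List.ofFn v) = ∑ j, v j ^ 2 := by
  rw [sqNormL, List.map_ofFn, List.sum_ofFn]
  simp only [Function.comp_apply]

/-- The squared norm vanishes exactly at `0`. [folklore] -/
theorem sqNormL_ofFn_eq_zero_iff (v : Fin n → ℤ) : sqNormL (List.ofFn v) = 0 ↔ v = 0 := by
  rw [sqNormL_ofFn]
  constructor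
  · intro h
    funext j
    have := (Finset.sum_eq_zero_iff_of_nonneg fun j _ => sq_nonneg (v j)).1 h j (Finset.mem_univ j)
    exact pow_eq_zero_iff two_ne_zero |>.1 this
  · rintro rfl
    simp

/-- Squared norms are nonnegative. [folklore] -/
theorem sqNormL_nonneg (v : List ℤ) : 0 ≤ sqNormL v := by
  rw [sqNormL]
  exact List.sum_nonneg (by
    intro x hx
    obtain ⟨y, -, rfl⟩ := List.mem_map.1 hx
    exact sq_nonneg y)

/-! ### Selecting the shortest nonzero candidate -/

/-- One step of the selection on the state `(found, best, q)` (`best` a candidate coefficient list,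
`q` the squared norm of its lattice vector): a candidate whose lattice vector is nonzero and shorter
than the current best (or the first nonzero one) replaces it. [cite: Regev2004, Thm. 1.1 (proof, p. 7: output the shortest vector found)] -/
def selStep (n : ℕ) (B : List (List ℤ)) (st : Bool × (List ℤ × ℤ)) (c : List ℤ) : Bool × (List ℤ × ℤ) :=
  if sqNormL (vecMulL n c B) = 0 then st
  else if !st.1 || decide (sqNormL (vecMulL n c B) < st.2.2) then (true, (c, sqNormL (vecMulL n c B))) else st

/-- The selection fold from an arbitrary state. [folklore] -/
def selectGo (n : ℕ) (B : List (List ℤ)) (cands : List (List ℤ)) (st : Bool × (List ℤ × ℤ)) : Bool × (List ℤ × ℤ) :=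
  cands.foldl (selStep n B) st

/-- **The selection**: the fold from "nothing found". [cite: Regev2004, Thm. 1.1 (proof, p. 7)] -/
def selectL (n : ℕ) (B : List (List ℤ)) (cands : List (List ℤ)) : Bool × (List ℤ × ℤ) := selectGo n B cands (false, ([], 0))

/-- **The output vector**: the lattice vector of the selected coefficient list (the zero vector if no
candidate has a nonzero lattice vector). [cite: Regev2004, Thm. 1.1 (proof, p. 7)] -/
def shortestVecL (n : ℕ) (B : List (List ℤ)) (cands : List (List ℤ)) : List ℤ := vecMulL n (selectL n B cands).2.1 B

/-- The selection fold on a cons (definitional). [folklore] -/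
theorem selectGo_cons (n : ℕ) (B : List (List ℤ)) (c : List ℤ) (cands : List (List ℤ)) (st : Bool × (List ℤ × ℤ)) :
    selectGo n B (c :: cands) st = selectGo n B cands (selStep n B st c) := rfl

/-- **The invariant of the selection fold**: not found means nothing processed had a nonzero lattice
vector (and the state is untouched); found means the state holds a processed candidate (or the
initial best) whose squared norm is the recorded `q ≠ 0`, minimal among the processed nonzero ones
and not above the initial one. [folklore] -/
theorem selectGo_inv (n : ℕ) (B : List (List ℤ)) : ∀ (cands : List (List ℤ)) (st : Bool × (List ℤ × ℤ)),
    (st.1 = true → sqNormL (vecMulL n st.2.1 B) = st.2.2 ∧ st.2.2 ≠ 0) →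
    ((selectGo n B cands st).1 = false → selectGo n B cands st = st ∧ ∀ c ∈ cands, sqNormL (vecMulL n c B) = 0) ∧
    ((selectGo n B cands st).1 = true →
        sqNormL (vecMulL n (selectGo n B cands st).2.1 B) = (selectGo n B cands st).2.2 ∧
        (selectGo n B cands st).2.2 ≠ 0 ∧
        ((selectGo n B cands st).2.1 ∈ cands ∨ (st.1 = true ∧ (selectGo n B cands st).2 = st.2)) ∧
        (st.1 = true → (selectGo n B cands st).2.2 ≤ st.2.2) ∧
        ∀ c ∈ cands, sqNormL (vecMulL n c B) ≠ 0 → (selectGo n B cands st).2.2 ≤ sqNormL (vecMulL n c B))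
  | [], st, hst => by
      have e : selectGo n B [] st = st := rfl
      rw [e]
      refine ⟨fun _ => ⟨rfl, fun c hc => by simp at hc⟩, fun h => ⟨(hst h).1, (hst h).2, Or.inr ⟨h, rfl⟩, fun _ => le_rfl,
        fun c hc => by simp at hc⟩⟩
  | c :: cands, st, hst => by
      rw [selectGo_cons]
      set qc := sqNormL (vecMulL n c B) with hqc
      by_cases hq : qc = 0
      · have e : selStep n B st c = st := by rw [selStep, ← hqc, if_pos hq]
        rw [e]
        obtain ⟨ih1, ih2⟩ := selectGo_inv n B cands st hst
        refine ⟨fun h => ⟨(ih1 h).1, fun c' hc' => ?_⟩, fun h => ?_⟩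
        · rcases List.mem_cons.1 hc' with rfl | hc'
          · exact hq
          · exact (ih1 h).2 c' hc'
        · obtain ⟨a1, a2, a3, a4, a5⟩ := ih2 h
          refine ⟨a1, a2, ?_, a4, fun c' hc' hne => ?_⟩
          · rcases a3 with a3 | a3
            · exact Or.inl (List.mem_cons_of_mem _ a3)
            · exact Or.inr a3
          · rcases List.mem_cons.1 hc' with rfl | hc'
            · exact absurd hq hne
            · exact a5 c' hc' hne
      · by_cases hrep : (!st.1 || decide (qc < st.2.2)) = true
        · have e : selStep n B st c = (true, (c, qc)) := by rw [selStep, ← hqc, if_neg hq, if_pos hrep]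
          rw [e]
          obtain ⟨ih1, ih2⟩ := selectGo_inv n B cands (true, (c, qc)) (fun _ => ⟨hqc.symm, hq⟩)
          refine ⟨fun h => ?_, fun h => ?_⟩
          · have := congrArg Prod.fst (ih1 h).1
            rw [h] at this
            exact absurd this (by simp)
          · obtain ⟨a1, a2, a3, a4, a5⟩ := ih2 h
            refine ⟨a1, a2, Or.inl ?_, fun hst1 => ?_, fun c' hc' hne => ?_⟩
            · rcases a3 with a3 | ⟨-, a3⟩
              · exact List.mem_cons_of_mem _ a3
              · have : (selectGo n B cands (true, (c, qc))).2.1 = c := by rw [a3]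
                rw [this]
                exact List.mem_cons_self
            · have hlt : qc < st.2.2 := by
                rw [hst1] at hrep
                simpa using hrep
              exact (a4 rfl).trans hlt.le
            · rcases List.mem_cons.1 hc' with rfl | hc'
              · exact a4 rfl
              · exact a5 c' hc' hne
        · have e : selStep n B st c = st := by rw [selStep, ← hqc, if_neg hq, if_neg hrep]
          rw [e]
          have hst1 : st.1 = true := by
            cases h1 : st.1
            · rw [h1] at hrep; simp at hrep
            · rfl
          have hle : st.2.2 ≤ qc := by
            rw [hst1] at hrep
            simpa using hrep
          obtain ⟨ih1, ih2⟩ := selectGo_inv n B cands st hst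
          refine ⟨fun h => ?_, fun h => ?_⟩
          · have := congrArg Prod.fst (ih1 h).1
            rw [h, hst1] at this
            exact absurd this (by simp)
          · obtain ⟨a1, a2, a3, a4, a5⟩ := ih2 h
            refine ⟨a1, a2, ?_, a4, fun c' hc' hne => ?_⟩
            · rcases a3 with a3 | a3
              · exact Or.inl (List.mem_cons_of_mem _ a3)
              · exact Or.inr a3
            · rcases List.mem_cons.1 hc' with rfl | hc'
              · exact (a4 hst1).trans hle
              · exact a5 c' hc' hne

/-- **Specification of the selection**: either no candidate has a nonzero lattice vector (flag
`false`, empty output), or the selected list is a candidate whose lattice vector has the least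
nonzero squared norm. [cite: Regev2004, Thm. 1.1 (proof, p. 7)] -/
theorem selectL_spec (n : ℕ) (B : List (List ℤ)) (cands : List (List ℤ)) :
    ((selectL n B cands).1 = false → (selectL n B cands) = (false, ([], 0)) ∧ ∀ c ∈ cands, sqNormL (vecMulL n c B) = 0) ∧
    ((selectL n B cands).1 = true → (selectL n B cands).2.1 ∈ cands ∧
      sqNormL (vecMulL n (selectL n B cands).2.1 B) = (selectL n B cands).2.2 ∧ (selectL n B cands).2.2 ≠ 0 ∧
      ∀ c ∈ cands, sqNormL (vecMulL n c B) ≠ 0 → (selectL n B cands).2.2 ≤ sqNormL (vecMulL n c B)) := by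
  obtain ⟨h1, h2⟩ := selectGo_inv n B cands (false, ([], 0)) (fun h => absurd h (by simp))
  refine ⟨fun h => h1 h, fun h => ?_⟩
  obtain ⟨a1, a2, a3, -, a5⟩ := h2 h
  refine ⟨?_, a1, a2, a5⟩
  rcases a3 with a3 | ⟨a3, -⟩
  · exact a3
  · exact absurd a3 (by simp)

/-! ### The selected vector solves unique-SVP -/

/-- The rows of the basis as a list of lists. [folklore] -/
def rowsOf (I : LatticeInstance) : List (List ℤ) := List.ofFn fun i => List.ofFn (I.basis i)

/-- A coefficient list read as a coefficient vector of dimension `n` (missing entries `0`). [folklore] -/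
def coeffOf (n : ℕ) (c : List ℤ) : Fin n → ℤ := fun i => c.getD i 0

/-- Only the first `n` entries of the coefficient list are read. [folklore] -/
theorem vecMulL_ofFn_coeffOf (n : ℕ) (c : List ℤ) (B : List (List ℤ)) :
    vecMulL n (List.ofFn (coeffOf n c)) B = vecMulL n c B := by
  unfold vecMulL
  refine List.map_congr_left fun j _ => ?_
  congr 1
  refine List.map_congr_left fun i hi => ?_
  rw [List.mem_range] at hi
  rw [getD_ofFn (coeffOf n c) 0 ⟨i, hi⟩]
  rfl

/-- **The list product is the lattice vector of the coefficients read off the list.** [folklore] -/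
theorem vecMulL_rowsOf (I : LatticeInstance) (c : List ℤ) :
    vecMulL I.n c (rowsOf I) = List.ofFn (Matrix.vecMul (coeffOf I.n c) I.basis) := by
  rw [← vecMulL_ofFn_coeffOf, rowsOf, vecMulL_ofFn]

/-- **The selection solves unique-SVP**: if the lattice vector of some candidate coefficient list is a
shortest nonzero vector of `L(B)`, then the selection finds a candidate and the output vector
`shortestVecL` is (the list of) a shortest nonzero vector of `L(B)`.
[cite: Regev2004, Thm. 1.1 (proof, p. 7: "with high probability one of the vectors found is the shortest vector")] -/
theorem isSolution_shortestVecL (I : LatticeInstance) (cands : List (List ℤ))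
    (h : ∃ c ∈ cands, USVP.IsSolution I (Matrix.vecMul (coeffOf I.n c) I.basis)) :
    (selectL I.n (rowsOf I) cands).1 = true ∧
      shortestVecL I.n (rowsOf I) cands = List.ofFn (Matrix.vecMul (coeffOf I.n (selectL I.n (rowsOf I) cands).2.1) I.basis) ∧
      USVP.IsSolution I (Matrix.vecMul (coeffOf I.n (selectL I.n (rowsOf I) cands).2.1) I.basis) := by
  obtain ⟨c₀, hc₀, hne₀, hmem₀, hnorm₀⟩ := h
  set v₀ := Matrix.vecMul (coeffOf I.n c₀) I.basis with hv₀
  obtain ⟨hfalse, htrue⟩ := selectL_spec I.n (rowsOf I) cands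
  have hq₀ : sqNormL (vecMulL I.n c₀ (rowsOf I)) ≠ 0 := by
    rw [vecMulL_rowsOf, ← hv₀, Ne, sqNormL_ofFn_eq_zero_iff]
    exact hne₀
  have hflag : (selectL I.n (rowsOf I) cands).1 = true := by
    by_contra hf
    rw [Bool.not_eq_true] at hf
    exact hq₀ ((hfalse hf).2 c₀ hc₀)
  obtain ⟨hsel, hq, hqne, hmin⟩ := htrue hflag
  set w := Matrix.vecMul (coeffOf I.n (selectL I.n (rowsOf I) cands).2.1) I.basis with hw
  refine ⟨hflag, vecMulL_rowsOf I _, ?_, I.ofCoeffs_mem_lattice _, ?_⟩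
  · -- nonzero: its squared norm is `q ≠ 0`
    intro hw0
    apply hqne
    rw [← hq, vecMulL_rowsOf, ← hw, hw0]
    simp [sqNormL_ofFn]
  · -- shortest: `‖w‖² = q ≤ ‖v₀‖² = λ₁²` and `λ₁ ≤ ‖w‖`
    have hwne : intVecToEuclidean I.n w ≠ 0 := by
      intro h0
      apply hqne
      rw [← hq, vecMulL_rowsOf, ← hw]
      rw [show w = 0 from intVecToEuclidean_injective I.n (by rw [h0, map_zero])]
      simp [sqNormL_ofFn]
    have hlow : minNorm I.lattice ≤ ‖intVecToEuclidean I.n w‖ := minNorm_le_norm_of_mem (I.ofCoeffs_mem_lattice _) hwne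
    have hup : ‖intVecToEuclidean I.n w‖ ^ 2 ≤ ‖intVecToEuclidean I.n v₀‖ ^ 2 := by
      rw [← sqNormL_ofFn_cast, ← sqNormL_ofFn_cast, ← vecMulL_rowsOf, ← vecMulL_rowsOf, hq]
      exact_mod_cast hmin c₀ hc₀ hq₀
    rw [hnorm₀] at hup
    have hn : 0 ≤ ‖intVecToEuclidean I.n w‖ := norm_nonneg _
    have h0 : 0 ≤ minNorm I.lattice := by
      rw [← hnorm₀]; exact norm_nonneg _
    nlinarith

/-! ### Size bounds for the selection fold -/

/-- Entries of `vecMulL` are bounded by `n C D` for coefficients bounded by `C` and basis entries by `D`. [folklore] -/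
theorem natAbs_le_of_mem_vecMulL {n C D : ℕ} {c : List ℤ} {B : List (List ℤ)} (hc : ∀ x ∈ c, x.natAbs ≤ C)
    (hB : ∀ row ∈ B, ∀ x ∈ row, x.natAbs ≤ D) {x : ℤ} (hx : x ∈ vecMulL n c B) : x.natAbs ≤ n * (C * D) := by
  rw [vecMulL, List.mem_map] at hx
  obtain ⟨j, -, rfl⟩ := hx
  have hterm : ∀ y ∈ (List.range n).map (fun i => c.getD i 0 * (B.getD i []).getD j 0), y.natAbs ≤ C * D := by
    intro y hy
    obtain ⟨i, -, rfl⟩ := List.mem_map.1 hy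
    rw [Int.natAbs_mul]
    refine Nat.mul_le_mul ?_ ?_
    · by_cases hi : i < c.length
      · rw [List.getD_eq_getElem _ _ hi]; exact hc _ (List.getElem_mem hi)
      · rw [List.getD_eq_default _ _ (not_lt.1 hi)]; simp
    · set row := B.getD i [] with hrow
      have hrowD : ∀ x ∈ row, x.natAbs ≤ D := by
        by_cases hi : i < B.length
        · rw [hrow, List.getD_eq_getElem _ _ hi]; exact hB _ (List.getElem_mem hi)
        · rw [hrow, List.getD_eq_default _ _ (not_lt.1 hi)]; simp
      by_cases hj : j < row.length
      · rw [List.getD_eq_getElem _ _ hj]; exact hrowD _ (List.getElem_mem hj)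
      · rw [List.getD_eq_default _ _ (not_lt.1 hj)]; simp
  refine (Literature.Computability.Complexity.CodeFP.natAbs_sum_le _).trans ?_
  refine (List.sum_le_card_nsmul _ (C * D) fun y hy => ?_).trans ?_
  · obtain ⟨z, hz, rfl⟩ := List.mem_map.1 hy
    exact hterm z hz
  · simp

/-- The squared norm of a list with entries bounded by `E` is at most `|v| E²`. [folklore] -/
theorem natAbs_sqNormL_le {v : List ℤ} {E : ℕ} (hv : ∀ x ∈ v, x.natAbs ≤ E) : (sqNormL v).natAbs ≤ v.length * E ^ 2 := by
  rw [sqNormL]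
  refine (Literature.Computability.Complexity.CodeFP.natAbs_sum_le _).trans ?_
  refine (List.sum_le_card_nsmul _ (E ^ 2) fun y hy => ?_).trans (by simp)
  obtain ⟨z, hz, rfl⟩ := List.mem_map.1 hy
  obtain ⟨x, hx, rfl⟩ := List.mem_map.1 hz
  rw [Int.natAbs_pow]
  exact Nat.pow_le_pow_left (hv x hx) 2

/-- `vecMulL` has `n` entries. [folklore] -/
@[simp] theorem length_vecMulL (n : ℕ) (c : List ℤ) (B : List (List ℤ)) : (vecMulL n c B).length = n := by
  simp [vecMulL]


/-! ### The programs on codes -/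

section FP

open _root_.Computability Polynomial Literature.Computability.Complexity
  Literature.Computability.Complexity.CodeFP Literature.Computability.Complexity.Brick

/-- Codes of `(1ⁿ, c, B)`. [folklore] -/
abbrev vmInE : ℕ × (List ℤ × List (List ℤ)) → List Bool := pairE unE (pairE (rawE intE) (rawE (rawE intE)))

/-- **`vecMulL` on codes**: `(1ⁿ, c, B) ↦ c ᵥ* B`. [cite: AroraBarak2009, §1.3] -/
theorem vecMulLFP : CodeFP vmInE (rawE intE) (fun p => vecMulL p.1 p.2.1 p.2.2) := by
  -- the term `cᵢ Bᵢⱼ`, context `((1ⁿ, c, B), j)`, item `i`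
  let cE : (ℕ × (List ℤ × List (List ℤ))) × ℕ → List Bool := pairE vmInE natE
  have hc : CodeFP (pairE cE natE) (rawE intE) (fun t => t.1.1.2.1) := (fst _ _).fst'.snd'.fst'
  have hB : CodeFP (pairE cE natE) (rawE (rawE intE)) (fun t => t.1.1.2.2) := (fst _ _).fst'.snd'.snd'
  have hj : CodeFP (pairE cE natE) natE (fun t => t.1.2) := (fst _ _).snd'
  have hi : CodeFP (pairE cE natE) natE (fun t => t.2) := snd _ _
  have hci : CodeFP (pairE cE natE) intE (fun t => t.1.1.2.1.getD t.2 0) := ((rawGetOr intE).comp (hc.pair (hi.pair (const _ (0 : ℤ)))) :)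
  have hrow : CodeFP (pairE cE natE) (rawE intE) (fun t => t.1.1.2.2.getD t.2 []) := ((rawGetD (rawE intE) (d := ([] : List ℤ)) rfl).comp (hB.pair hi) :)
  have hBij : CodeFP (pairE cE natE) intE (fun t => (t.1.1.2.2.getD t.2 []).getD t.1.2 0) :=
    ((rawGetOr intE).comp (hrow.pair (hj.pair (const _ (0 : ℤ)))) :)
  have hterm : CodeFP (pairE cE natE) intE (fun t => t.1.1.2.1.getD t.2 0 * (t.1.1.2.2.getD t.2 []).getD t.1.2 0) :=
    (intMul.comp (hci.pair hBij) :)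
  -- the entry `j`: context `(1ⁿ, c, B)`, item `j`
  have hrangeI : CodeFP cE (rawE natE) (fun q => List.range q.1.1) := urange.comp (fst _ _).fst'
  have hentry : CodeFP cE intE (fun q => ((List.range q.1.1).map fun i => q.1.2.1.getD i 0 * (q.1.2.2.getD i []).getD q.2 0).sum) :=
    (intSum.comp ((map hterm).comp ((CodeFP.id cE).pair hrangeI)) :)
  have hrangeO : CodeFP vmInE (rawE natE) (fun p => List.range p.1) := urange.comp (fst _ _)
  exact ((map hentry).comp ((CodeFP.id vmInE).pair hrangeO)).congr fun _ => rfl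

/-- **`sqNormL` on codes.** [cite: AroraBarak2009, §1.3] -/
theorem sqNormLFP : CodeFP (rawE intE) intE sqNormL :=
  (intSum.comp (map₀ (intMul.comp ((CodeFP.id intE).pair (CodeFP.id intE))))).congr fun v => by
    rw [sqNormL]
    congr 1
    exact List.map_congr_left fun x _ => by simp only [id]; ring

/-- Codes of the selection context `(1ⁿ, B)` and state `(found, best, q)`. [folklore] -/
abbrev selCtxE : ℕ × List (List ℤ) → List Bool := pairE unE (rawE (rawE intE))

/-- The code of the selection state. [folklore] -/
abbrev selStE : Bool × (List ℤ × ℤ) → List Bool := pairE bitE (pairE (rawE intE) intE)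

/-- **One selection step on codes.** [cite: AroraBarak2009, §1.3] -/
theorem selStepFP : CodeFP (pairE selCtxE (pairE (rawE intE) selStE)) selStE (fun u => selStep u.1.1 u.1.2 u.2.2 u.2.1) := by
  let rE : (ℕ × List (List ℤ)) × (List ℤ × (Bool × (List ℤ × ℤ))) → List Bool := pairE selCtxE (pairE (rawE intE) selStE)
  have hn : CodeFP rE unE (fun u => u.1.1) := (fst _ _).fst'
  have hB : CodeFP rE (rawE (rawE intE)) (fun u => u.1.2) := (fst _ _).snd'
  have hc : CodeFP rE (rawE intE) (fun u => u.2.1) := (snd _ _).fst'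
  have hst : CodeFP rE selStE (fun u => u.2.2) := (snd _ _).snd'
  have hflag : CodeFP rE bitE (fun u => u.2.2.1) := hst.fst'
  have hq0 : CodeFP rE intE (fun u => u.2.2.2.2) := hst.snd'.snd'
  have hq : CodeFP rE intE (fun u => sqNormL (vecMulL u.1.1 u.2.1 u.1.2)) := (sqNormLFP.comp (vecMulLFP.comp (hn.pair (hc.pair hB))) :)
  have hzero : CodeFP rE bitE (fun u => decide (sqNormL (vecMulL u.1.1 u.2.1 u.1.2) = 0)) := (intEq.comp (hq.pair (const _ (0 : ℤ))) :)
  have hrep : CodeFP rE bitE (fun u => !u.2.2.1 || decide (sqNormL (vecMulL u.1.1 u.2.1 u.1.2) < u.2.2.2.2)) :=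
    (hflag.not.or (intLt.comp (hq.pair hq0)) :)
  have hnew : CodeFP rE selStE (fun u => (true, (u.2.1, sqNormL (vecMulL u.1.1 u.2.1 u.1.2)))) := (const _ true).pair (hc.pair hq)
  refine ((hzero.ite hst (hrep.ite hnew hst)).congr fun u => ?_)
  simp only [selStep, decide_eq_true_eq]

/-- **The selection fold on codes**: `((1ⁿ, B), candidates) ↦ selectL n B candidates`; the accumulator is a
candidate item and one integer of polynomial size (`natAbs_sqNormL_le`). [cite: AroraBarak2009, §1.3] -/
theorem selectLFP : CodeFP (pairE selCtxE (rawE (rawE intE))) selStE (fun p => selectL p.1.1 p.1.2 p.2) := by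
  have hinit : CodeFP selCtxE selStE (fun _ => (false, (([] : List ℤ), (0 : ℤ)))) := const _ _
  have h := foldl (step := fun (s : ℕ × List (List ℤ)) (c : List ℤ) st => selStep s.1 s.2 st c)
    (init := fun _ => (false, (([] : List ℤ), (0 : ℤ)))) selStepFP hinit (24 * X + 16)
    (fun s l₁ l₂ => by
      obtain ⟨n, B⟩ := s
      have e : l₁.foldl (fun st c => selStep n B st c) (false, ([], 0)) = selectGo n B l₁ (false, ([], 0)) := rfl
      rw [e]
      set L := (pairE selCtxE (rawE (rawE intE)) ((n, B), l₁ ++ l₂)).length with hL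
      have hLeq : L = 2 * (2 * n + 2 + (rawE (rawE intE) B).length) + 2 + (rawE (rawE intE) (l₁ ++ l₂)).length := by
        simp [hL]
      obtain ⟨ih1, ih2⟩ := selectGo_inv n B l₁ (false, ([], 0)) (fun h => absurd h (by simp))
      set r := selectGo n B l₁ (false, ([], 0)) with hr
      simp only [eval_add, eval_mul, eval_X, eval_ofNat]
      cases hf : r.1
      · rw [(ih1 hf).1]
        simp [pairE_apply, length_boolPair, bitE, dpEnc_zero]
      · obtain ⟨a1, -, a3, -, -⟩ := ih2 hf
        have hmem : r.2.1 ∈ l₁ := by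
          rcases a3 with a3 | ⟨a3, -⟩
          · exact a3
          · exact absurd a3 (by simp)
        -- the best list is an input item
        have hbest : (rawE intE r.2.1).length ≤ L := by
          have := length_item_le_length_rawE (rawE intE) (List.mem_append_left l₂ hmem)
          omega
        -- its squared norm is below `2^(7L)`
        set M := 2 ^ L with hM
        have hLM : L < M := Nat.lt_two_pow_self
        have hn : n ≤ L := by omega
        have hC : ∀ x ∈ r.2.1, x.natAbs ≤ M := fun x hx => by
          have h1 := length_item_le_length_rawE intE hx
          have h2 := size_natAbs_le_length_intE x
          have h3 := Nat.lt_size_self x.natAbs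
          exact (h3.trans_le (Nat.pow_le_pow_right (by norm_num) (by omega))).le
        have hD : ∀ row ∈ B, ∀ x ∈ row, x.natAbs ≤ M := fun row hrow x hx => by
          have h1 := length_item_le_length_rawE intE hx
          have h2 := length_item_le_length_rawE (rawE intE) hrow
          have h3 := size_natAbs_le_length_intE x
          have h4 := Nat.lt_size_self x.natAbs
          exact (h4.trans_le (Nat.pow_le_pow_right (by norm_num) (by omega))).le
        have hent : ∀ x ∈ vecMulL n r.2.1 B, x.natAbs ≤ n * (M * M) := fun x hx => natAbs_le_of_mem_vecMulL hC hD hx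
        have hqv : (sqNormL (vecMulL n r.2.1 B)).natAbs ≤ n * (n * (M * M)) ^ 2 := by
          have := natAbs_sqNormL_le hent
          rwa [length_vecMulL] at this
        have hq7 : r.2.2.natAbs ≤ 2 ^ (7 * L) := by
          rw [← a1]
          have h1 : n * (n * (M * M)) ^ 2 ≤ M * (M * (M * M)) ^ 2 :=
            Nat.mul_le_mul (hn.trans hLM.le) (Nat.pow_le_pow_left (Nat.mul_le_mul_right _ (hn.trans hLM.le)) 2)
          have h2 : M * (M * (M * M)) ^ 2 = 2 ^ (7 * L) := by rw [hM]; ring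
          exact hqv.trans (h1.trans h2.le)
        have hsize : Nat.size r.2.2.natAbs ≤ 7 * L + 1 := by
          rw [Nat.size_le]
          exact lt_of_le_of_lt hq7 (Nat.pow_lt_pow_right (by norm_num) (Nat.lt_succ_self _))
        have hqlen : (intE r.2.2).length ≤ 3 * (7 * L + 1) + 2 := (length_dpEnc_le _).trans (by omega)
        simp only [selStE, pairE_apply, length_boolPair, bitE, List.length_singleton]
        omega)
  exact h.congr fun _ => rfl

/-- **The output vector on codes**: `((1ⁿ, B), candidates) ↦ shortestVecL n B candidates`.
[cite: Regev2004, Thm. 1.1 (proof, p. 7); AroraBarak2009, §1.3] -/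
theorem shortestVecLFP : CodeFP (pairE selCtxE (rawE (rawE intE))) (rawE intE) (fun p => shortestVecL p.1.1 p.1.2 p.2) :=
  (vecMulLFP.comp ((fst _ _).fst'.pair (selectLFP.snd'.fst'.pair (fst _ _).snd'))).congr fun _ => rfl

/-- `shiftToCoeffs` on lists: replace entry `i₀` of `δ̄` by `p δ_{i₀} + m`. [cite: Regev2004, Thm. 1.1 (proof, p. 7)] -/
def shiftToCoeffsL (i₀ : ℕ) (p m : ℤ) (δ : List ℤ) : List ℤ := δ.set i₀ (p * δ.getD i₀ 0 + m)

/-- **The list version is `shiftToCoeffs`** on genuine codes. [folklore] -/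
theorem shiftToCoeffsL_ofFn (i₀ : Fin n) (p m : ℤ) (d : Fin n → ℤ) :
    shiftToCoeffsL i₀ p m (List.ofFn d) = List.ofFn (shiftToCoeffs i₀ p m d) := by
  rw [shiftToCoeffsL, getD_ofFn d 0 i₀]
  apply List.ext_getElem (by simp)
  intro k h₁ h₂
  rw [List.length_ofFn] at h₂
  simp only [List.getElem_set, List.getElem_ofFn, shiftToCoeffs, Function.update_apply]
  by_cases hk : (i₀ : ℕ) = k
  · have : (⟨k, h₂⟩ : Fin n) = i₀ := Fin.ext hk.symm
    rw [if_pos hk, if_pos this]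
  · have : (⟨k, h₂⟩ : Fin n) ≠ i₀ := fun h => hk (by rw [← h])
    rw [if_neg hk, if_neg this]

/-- **`shiftToCoeffs` on codes**: `(i₀, p, m, δ̄) ↦ shiftToCoeffsL i₀ p m δ̄`. [cite: AroraBarak2009, §1.3] -/
theorem shiftToCoeffsFP : CodeFP (pairE natE (pairE intE (pairE intE (rawE intE)))) (rawE intE)
    (fun a => shiftToCoeffsL a.1 a.2.1 a.2.2.1 a.2.2.2) := by
  let aE : ℕ × (ℤ × (ℤ × List ℤ)) → List Bool := pairE natE (pairE intE (pairE intE (rawE intE)))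
  have hi : CodeFP aE natE (fun a => a.1) := fst _ _
  have hp : CodeFP aE intE (fun a => a.2.1) := (snd _ _).fst'
  have hm : CodeFP aE intE (fun a => a.2.2.1) := (snd _ _).snd'.fst'
  have hδ : CodeFP aE (rawE intE) (fun a => a.2.2.2) := (snd _ _).snd'.snd'
  have hget : CodeFP aE intE (fun a => a.2.2.2.getD a.1 0) := ((rawGetOr intE).comp (hδ.pair (hi.pair (const _ (0 : ℤ)))) :)
  have hval : CodeFP aE intE (fun a => a.2.1 * a.2.2.2.getD a.1 0 + a.2.2.1) := (intAdd.comp ((intMul.comp (hp.pair hget)).pair hm) :)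
  exact (((setAt intE).comp (hδ.pair (hi.pair hval))).congr fun _ => rfl :)

/-- **The candidate of one run on codes**: `((bin i₀, p, m), (1ⁿ, bin M, bin d)) ↦
shiftToCoeffsL i₀ p m (decodeShift (2M) M n d)` — decode the DCP answer and undo the shift.
[cite: Regev2004, Thm. 1.1 (proof, p. 7); AroraBarak2009, §1.3] -/
theorem candidateFP : CodeFP (pairE (pairE natE (pairE intE intE)) (pairE unE (pairE natE natE))) (rawE intE)
    (fun a => shiftToCoeffsL a.1.1 a.1.2.1 a.1.2.2 (List.ofFn (decodeShift (2 * a.2.2.1) a.2.2.1 a.2.1 a.2.2.2))) :=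
  (shiftToCoeffsFP.comp ((fst _ _).fst'.pair ((fst _ _).snd'.fst'.pair ((fst _ _).snd'.snd'.pair
    (decodeShiftFP.comp (snd _ _)))))).congr fun _ => rfl

/-- **What the candidate of the right guess is**: the list of the coefficients `u` of the shortest vector.
[cite: Regev2004, Thm. 1.1 (proof, p. 7)] -/
theorem candidate_eq_ofFn (i₀ : Fin n) {p m : ℤ} {u : Fin n → ℤ} {M : ℕ} (hum : p ∣ u i₀ - m)
    (hM : ∀ i, (u i).natAbs + m.natAbs < M) :
    shiftToCoeffsL i₀ p m (List.ofFn (decodeShift (2 * M) M n (dcpShift (2 * M) n (hiddenShift i₀ p m u)))) = List.ofFn u := by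
  rw [shiftToCoeffsL_ofFn, shiftToCoeffs_decodeShift_dcpShift i₀ hum hM]

/-- **The output convention**: `encodeIntVec ⟨n, v⟩` is the code of the triple `(n, n, v)` under
`pairE natE (pairE unE (rawE smE))` (binary dimension header, then Mathlib's `listBool` code of the
sign–magnitude entries). [cite: AroraBarak2009, §0.1] -/
theorem encodeIntVec_eq_pairE (v : Fin n → ℤ) :
    encodeIntVec ⟨n, v⟩ = pairE natE (pairE unE (rawE smE)) (n, (n, List.ofFn v)) := by
  rw [encodeIntVec_eq, encodingIntVecFin]
  change encodeNatSD n ++ encodingIntBool.listBool.encode (List.ofFn v) = _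
  rw [listE_eq, pairE_apply, pairE_apply, ← boolPair_encodeNat]
  simp [listE, smE]

/-- **Writing the answer in the output convention is polynomial time**: the raw list of an integer
vector `↦ encodeIntVec ⟨n, v⟩` (the prefix demanded by `usvpOutputs`). [cite: AroraBarak2009, §0.1 and §1.3] -/
theorem outputFP : CodeFP (rawE intE) (pairE natE (pairE unE (rawE smE))) (fun l => (l.length, (l.length, l))) :=
  (natLength intE).pair ((ulength intE).pair (map₀ smOfInt)) |>.congr fun l => by simp

/-- The output map on genuine vectors, unpacked: an `FP` string function with
`f (rawE intE (List.ofFn v)) = encodeIntVec ⟨n, v⟩`. [cite: AroraBarak2009, §0.1 and §1.3] -/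
theorem exists_fp_encodeIntVec : ∃ f ∈ FP, ∀ (n : ℕ) (v : Fin n → ℤ), f (rawE intE (List.ofFn v)) = encodeIntVec ⟨n, v⟩ := by
  obtain ⟨f, hf, h⟩ := outputFP
  refine ⟨f, hf, fun n v => ?_⟩
  rw [h, encodeIntVec_eq_pairE]
  simp only [List.length_ofFn]

/-- **Unpacked forms.** An `FP` string function maps `⟨⟨1ⁿ, B⟩, candidates⟩` (basis and candidates as
raw lists of raw lists of integers) to the raw list of `shortestVecL n B candidates`; another maps
`⟨bin i₀, ⟨p, ⟨m, δ̄⟩⟩⟩` to `shiftToCoeffsL i₀ p m δ̄`. [cite: Regev2004, Thm. 1.1 (proof, p. 7)] -/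
theorem exists_fp_shortestVecL :
    (∃ f ∈ FP, ∀ (n : ℕ) (B cands : List (List ℤ)),
      f (boolPair (boolPair (unE n) (rawE (rawE intE) B)) (rawE (rawE intE) cands)) = rawE intE (shortestVecL n B cands)) ∧
    (∃ f ∈ FP, ∀ (i₀ : ℕ) (p m : ℤ) (δ : List ℤ),
      f (boolPair (natE i₀) (boolPair (intE p) (boolPair (intE m) (rawE intE δ)))) = rawE intE (shiftToCoeffsL i₀ p m δ)) := by
  obtain ⟨f, hf, h⟩ := shortestVecLFP
  obtain ⟨g, hg, h'⟩ := shiftToCoeffsFP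
  exact ⟨⟨f, hf, fun n B cands => h ((n, B), cands)⟩, ⟨g, hg, fun i₀ p m δ => h' (i₀, (p, (m, δ)))⟩⟩

end FP

end Regev2004

end Literature.Algebra.EuclideanLattices
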